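import Summits.HubbardSuperconductivity.HubbardSuperconductivity.Theorems.NodalWardXYPerturbedXYOrderTwistEvenResponse
import Summits.HubbardSuperconductivity.HubbardSuperconductivity.Theorems.NodalWardXYPerturbedXYOrderTwistReflection

/-!
# `PerturbedXYOrder` (stmt-HubbardSuperconductivity-10739) — line `schwarz-inheritance`, stub `stub_twistExpectationShift`

**Twist decoupling of admissible two-current tilts, III: no first-order response in the rotator state.**

For every kernel `K` admissible at radius `ε` (`‖K(b,b')‖ ≤ ε(1+dist)⁻⁴`), every coupling `J` and every site-dependent
rotation `g` of the torus `(ℤ/Lℤ)³`,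

  `‖∫_cube (W_K(θ + g) − W_K(θ)) w_J(θ) dθ‖ ≤ 288 ε Σ_b (1 − cos ∇_b g) · ∫_cube w_J`,

i.e. `⟨W_K ∘ τ_g⟩_J − ⟨W_K⟩_J = O(ε Σ_b (1 − cos ∇_b g))` with NO term linear in the twist.  Proof: the spin-flip symmetry
`θ ↦ 2π − θ` of the rotator weight gives `∫ W_K(θ+g) w_J = ∫ W_K(θ−g) w_J` (`stub_twistReflection`, p161254), so the rotator
integral of `W_K(θ+g)` is that of the symmetrised twist `½(W_K(θ+g) + W_K(θ−g))`, which differs from `W_K` pointwise by at most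
`288 ε Σ_b (1 − cos ∇_b g)` (`stub_twistEvenResponse`, p160907); and `‖w_J‖ = w_J > 0`.

So the symmetric low-temperature state sees an admissible tilt as twist-invariant up to `288 ε / J ×` the twist's own spin-wave
energy `J Σ_b (1 − cos ∇_b g)`: the linear coupling of `W_K` to the Goldstone (twist) modes vanishes identically and the quadratic one
is dominated by the stiffness as soon as `J > 288 ε`.  This is the expectation-level form of the decoupling that protects the crux
from the Goldstone pinching of the invariant long-range sources (p156901, p158891).
-/

noncomputable section

namespace Summit.HubbardSuperconductivity.HubbardSuperconductivity.Theorems.PerturbedXYOrder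

open MeasureTheory Literature.Probability.LatticeModels
open Summit.HubbardSuperconductivity.HubbardSuperconductivity.Theses.NodalWardXY

variable {L : ℕ}

/-- The ferromagnetic weight is a positive real number: `‖w_J(θ)‖ = Re w_J(θ)`. -/
theorem tes_norm_wJ [NeZero L] (J : ℝ) (θ : TorusSite 3 L → ℝ) : ‖wJ J θ‖ = (wJ J θ).re := by
  unfold wJ
  rw [Complex.norm_real, Complex.ofReal_re, Real.norm_eq_abs, abs_of_pos (Real.exp_pos _)]

/-- Continuous complex functions of the configuration are integrable on the cube. -/
theorem tes_integrable [NeZero L] {f : (TorusSite 3 L → ℝ) → ℂ} (hf : Continuous f) :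
    Integrable f (volume.restrict (cube L)) :=
  hf.continuousOn.integrableOn_compact ent_isCompact_cube

/-- `θ ↦ W_K(θ + g) w_J(θ)` is continuous. -/
theorem tes_continuous_twisted [NeZero L] (J : ℝ) (K : Bond L → Bond L → ℂ) (g : TorusSite 3 L → ℝ) :
    Continuous fun θ : TorusSite 3 L → ℝ => Wk K (θ + g) * wJ J θ :=
  ((ent_continuous_Wk K).comp (continuous_id.add continuous_const)).mul (ent_continuous_wJ J)

/-- `θ ↦ W_K(θ − g) w_J(θ)` is continuous. -/
theorem tes_continuous_twisted_sub [NeZero L] (J : ℝ) (K : Bond L → Bond L → ℂ) (g : TorusSite 3 L → ℝ) :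
    Continuous fun θ : TorusSite 3 L → ℝ => Wk K (θ - g) * wJ J θ :=
  ((ent_continuous_Wk K).comp (continuous_id.sub continuous_const)).mul (ent_continuous_wJ J)

/-- `θ ↦ W_K(θ) w_J(θ)` is continuous. -/
theorem tes_continuous_untwisted [NeZero L] (J : ℝ) (K : Bond L → Bond L → ℂ) :
    Continuous fun θ : TorusSite 3 L → ℝ => Wk K θ * wJ J θ :=
  (ent_continuous_Wk K).mul (ent_continuous_wJ J)

/-- **Symmetrisation under the rotator weight**: by the spin-flip symmetry, the rotator integral of the twisted tilt minus the
tilt equals that of the symmetrised twist response. -/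
theorem tes_integral_sub_eq_symm [NeZero L] (J : ℝ) (K : Bond L → Bond L → ℂ) (g : TorusSite 3 L → ℝ) :
    (∫ θ in cube L, Wk K (θ + g) * wJ J θ) - ∫ θ in cube L, Wk K θ * wJ J θ =
      ∫ θ in cube L, ((Wk K (θ + g) + Wk K (θ - g)) / 2 - Wk K θ) * wJ J θ := by
  have hD := stub_twistReflection L J K g
  have h1 := tes_integrable (L := L) (tes_continuous_twisted J K g)
  have h2 := tes_integrable (L := L) (tes_continuous_twisted_sub J K g)
  have h0 := tes_integrable (L := L) (tes_continuous_untwisted J K)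
  have hsplit : (fun θ : TorusSite 3 L → ℝ => ((Wk K (θ + g) + Wk K (θ - g)) / 2 - Wk K θ) * wJ J θ) =
      fun θ => ((1 / 2 : ℂ) * (Wk K (θ + g) * wJ J θ) + (1 / 2 : ℂ) * (Wk K (θ - g) * wJ J θ)) - Wk K θ * wJ J θ := by
    funext θ; ring
  have h1' : Integrable (fun θ : TorusSite 3 L → ℝ => (1 / 2 : ℂ) * (Wk K (θ + g) * wJ J θ)) (volume.restrict (cube L)) :=
    h1.const_mul _
  have h2' : Integrable (fun θ : TorusSite 3 L → ℝ => (1 / 2 : ℂ) * (Wk K (θ - g) * wJ J θ)) (volume.restrict (cube L)) :=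
    h2.const_mul _
  have h12 : Integrable (fun θ : TorusSite 3 L → ℝ =>
      (1 / 2 : ℂ) * (Wk K (θ + g) * wJ J θ) + (1 / 2 : ℂ) * (Wk K (θ - g) * wJ J θ)) (volume.restrict (cube L)) :=
    h1'.add h2'
  have e1 : (∫ θ in cube L, ((1 / 2 : ℂ) * (Wk K (θ + g) * wJ J θ) + (1 / 2 : ℂ) * (Wk K (θ - g) * wJ J θ)) - Wk K θ * wJ J θ) =
      (∫ θ in cube L, (1 / 2 : ℂ) * (Wk K (θ + g) * wJ J θ) + (1 / 2 : ℂ) * (Wk K (θ - g) * wJ J θ)) -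
        ∫ θ in cube L, Wk K θ * wJ J θ := integral_sub h12 h0
  have e2 : (∫ θ in cube L, (1 / 2 : ℂ) * (Wk K (θ + g) * wJ J θ) + (1 / 2 : ℂ) * (Wk K (θ - g) * wJ J θ)) =
      (∫ θ in cube L, (1 / 2 : ℂ) * (Wk K (θ + g) * wJ J θ)) + ∫ θ in cube L, (1 / 2 : ℂ) * (Wk K (θ - g) * wJ J θ) :=
    integral_add h1' h2'
  have e3 : (∫ θ in cube L, (1 / 2 : ℂ) * (Wk K (θ + g) * wJ J θ)) = (1 / 2 : ℂ) * ∫ θ in cube L, Wk K (θ + g) * wJ J θ :=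
    integral_const_mul _ _
  have e4 : (∫ θ in cube L, (1 / 2 : ℂ) * (Wk K (θ - g) * wJ J θ)) = (1 / 2 : ℂ) * ∫ θ in cube L, Wk K (θ - g) * wJ J θ :=
    integral_const_mul _ _
  rw [hsplit, e1, e2, e3, e4, ← hD]
  ring

/-- STUB `stub_twistExpectationShift` (registered on stmt-HubbardSuperconductivity-10739, line `schwarz-inheritance`, skeleton rev 22c,
lead c20): **no first-order twist response of an admissible tilt in the rotator state.**  For every kernel `K` admissible at radius
`ε`, every coupling `J` and every site-dependent rotation `g`,
`‖∫_cube (W_K(θ+g) − W_K(θ)) w_J‖ ≤ 288 ε Σ_b (1 − cos ∇_b g) · ∫_cube w_J` (`stub_twistReflection` symmetrises the twist under the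
rotator weight, `stub_twistEvenResponse` bounds the symmetrised response pointwise, `‖w_J‖ = w_J`). [folklore] -/
theorem stub_twistExpectationShift : ∀ (L : ℕ) [NeZero L] (J ε : ℝ) (K : Bond L → Bond L → ℂ), Admissible L ε K →
    ∀ g : TorusSite 3 L → ℝ,
      ‖(∫ θ in cube L, Wk K (θ + g) * wJ J θ) - ∫ θ in cube L, Wk K θ * wJ J θ‖ ≤
        288 * ε * (∑ b : Bond L, (1 - Real.cos (g (b.1 + Pi.single b.2 1) - g b.1))) * ∫ θ in cube L, (wJ J θ).re := by
  intro L _ J ε K hK g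
  set C : ℝ := 288 * ε * ∑ b : Bond L, (1 - Real.cos (g (b.1 + Pi.single b.2 1) - g b.1)) with hC
  have hwc : Continuous fun θ : TorusSite 3 L → ℝ => (wJ J θ).re := Complex.continuous_re.comp (ent_continuous_wJ J)
  have hwi : Integrable (fun θ : TorusSite 3 L → ℝ => (wJ J θ).re) (volume.restrict (cube L)) :=
    hwc.continuousOn.integrableOn_compact ent_isCompact_cube
  rw [tes_integral_sub_eq_symm J K g]
  have hpt : ∀ θ : TorusSite 3 L → ℝ,
      ‖((Wk K (θ + g) + Wk K (θ - g)) / 2 - Wk K θ) * wJ J θ‖ ≤ C * (wJ J θ).re := by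
    intro θ
    rw [norm_mul, tes_norm_wJ]
    exact mul_le_mul_of_nonneg_right (stub_twistEvenResponse L ε K hK θ g)
      (by rw [← tes_norm_wJ]; exact norm_nonneg _)
  calc ‖∫ θ in cube L, ((Wk K (θ + g) + Wk K (θ - g)) / 2 - Wk K θ) * wJ J θ‖
      ≤ ∫ θ in cube L, C * (wJ J θ).re :=
        norm_integral_le_of_norm_le (hwi.const_mul C) (ae_of_all _ hpt)
    _ = C * ∫ θ in cube L, (wJ J θ).re := integral_const_mul _ _

end Summit.HubbardSuperconductivity.HubbardSuperconductivity.Theorems.PerturbedXYOrder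

end
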